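import Mathlib
import HarnessLib
import Summits.HubbardSuperconductivity.HubbardSuperconductivity.Theorems.KLProgrammeKLRegimeSplitTwoLegSizesMSFitPiecesSlot

/-!
# Route `KLProgramme`, crux K3 — ENGINE child (`KLRegimeEngineV16`, `stub_twoLeg_scale0`, clause (E3a-MS-Q)): the SLOT fits AT SCALE `0`
# by dilation covariance of the generic fit arithmetic (k3c3-p1 g4)

Seat hubbard-kl-k3c3-p1 (g4).  k3c3-p3's generic slot lemmas `ms_slot_fit_zero … four` (`…MSFitSlot0 … 4`) are pure real inequalities in free
reals `X, η, l, e₀, A₃, A₄, U, x, y, G_l, lam3, lam4, CE, S1, S1'` and profiles `εm, σ1, μ, ν`, valid on `4 ≤ y`, `4y ≤ x`; their tree wrappers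
(`…MSFitPiecesSlot`) read them at `y = 4^{n₀}`, `x = 4^m`, hence need `1 ≤ n₀`.  AT SCALE `n₀ = 0` (`y = 1`) the SAME lemmas apply after a
DILATION BY `4`: `y := 4^1`, `x := 4^(m+1)`, `G_l := 16·Gfr_l` (order-`l` sizes scale by `4^l = 16·4^(l−2)`), `μ_l := 16·mu_l/4^l`, `ν_l := 4·nu_l/4^l`,
`CE := Q.CE·4^(1−j)`, `lam := lam/64, lam/256` — every hypothesis then matches the TRUE scale-0 table entries of `msSizeSlotO_le_j` (`η`, `e₀` exactly,
`l ≤ 2x`, `A₃/A₄` termwise) and the right-hand side equals `msBarQ G Q U 0 · pieceSize R U m j`.  Hence, with the rescaled profile constants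
`msMuZ mu`, `msNuZ nu` and frame constants `msRenZ R` (`Gfr ↦ 16·Gfr`):

* **`msPieceSlotL_le_scaleZero`** — `∀ j ≤ 4, msPieceSlotL X σ ε R c U (4^0) 0 Λ₃ Λ₄ m j ≤ msBarQ G Q U 0 · (Gfr_j·uPow j U·4^((j−2)m))` for every slot
  `m ≥ 1`, from `0 < U ≤ 1`, the chain regime, `Λ₃ ≤ 64·lam3·Gfr₁U²`, `Λ₄ ≤ 256·lam4·Gfr₁U²`, the scale-0 profiles `σ (m−1) l ≤ mu_l·U²·4^{2−l}·c_l`,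
  `ε m l ≤ nu_l·U²·pieceSize R U m l` (written out) and ONE package line per order
  `msReqSlot X (msMuZ mu) (msNuZ nu) (msRenZ R) lam3 lam4 j ≤ 64·Q.CE·G.S 1·R.Gfr j/4^j` — the SAME requirement polynomials as at the scales `≥ 1`.

Proofs only (instantiation + `ring`); nothing about the model.
-/

noncomputable section

namespace Summit.HubbardSuperconductivity.HubbardSuperconductivity.Theorems.KLRegimeSplit

set_option linter.dupNamespace false -- summit = problem name (single-conjunct summit), D-0017

open Real Finset Summit.HubbardSuperconductivity.HubbardSuperconductivity.Theorems.PerturbedFermiCurve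

/-! ## §1 The rescaled constants of the dilation -/

/-- Rescaled increment-profile constants at scale `0`: `msMuZ mu l = 16·mu l/4^l`. -/
def msMuZ (mu : ℕ → ℝ) (l : ℕ) : ℝ := 16 * mu l / 4 ^ l

/-- Rescaled response-profile constants at scale `0`: `msNuZ nu l = 4·nu l/4^l`. -/
def msNuZ (nu : ℕ → ℝ) (l : ℕ) : ℝ := 4 * nu l / 4 ^ l

/-- Rescaled frame constants at scale `0`: `Gfr ↦ 16·Gfr` (the dilation by `4` multiplies order-`l` sizes by `4^l = 16·4^(l−2)`). -/
def msRenZ (R : RenConsts) : RenConsts := ⟨R.cr, R.cz, fun l => 16 * R.Gfr l⟩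

/-- `msMuZ` preserves signs. -/
theorem msMuZ_nonneg {mu : ℕ → ℝ} (h : ∀ i, 0 ≤ mu i) : ∀ i, 0 ≤ msMuZ mu i := by
  intro i; have := h i; unfold msMuZ; positivity

/-- `msNuZ` preserves signs. -/
theorem msNuZ_nonneg {nu : ℕ → ℝ} (h : ∀ i, 0 ≤ nu i) : ∀ i, 0 ≤ msNuZ nu i := by
  intro i; have := h i; unfold msNuZ; positivity

/-- `(msRenZ R).Gfr l = 16·R.Gfr l`. -/
theorem msRenZ_gfr (R : RenConsts) (l : ℕ) : (msRenZ R).Gfr l = 16 * R.Gfr l := rfl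

/-- The scale-0 order-3 slot budget shape sits below the dilated shape. -/
theorem msShapeZ3_slot {R : RenConsts} (hR : ∀ j, 0 ≤ R.Gfr j) (U : ℝ) (m : ℕ) (lam3 : ℝ) :
    4 / 3 * R.Gfr 3 * U ^ 2 * (4 : ℝ) ^ 0 + 64 * lam3 * R.Gfr 1 * U ^ 2 * (4 : ℝ) ^ 0 + 16 / 3 * R.Gfr 3 * U ^ 2 * (4 : ℝ) ^ m ≤
      4 / 3 * (16 * R.Gfr 3) * U ^ 2 * (4 : ℝ) ^ 1 + lam3 * (16 * R.Gfr 1) * U ^ 2 * (4 : ℝ) ^ 1 +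
        16 / 3 * (16 * R.Gfr 3) * U ^ 2 * (4 : ℝ) ^ (m + 1) := by
  have h3 := hR 3
  rw [← sub_nonneg]
  have e : 4 / 3 * (16 * R.Gfr 3) * U ^ 2 * (4 : ℝ) ^ 1 + lam3 * (16 * R.Gfr 1) * U ^ 2 * (4 : ℝ) ^ 1 +
      16 / 3 * (16 * R.Gfr 3) * U ^ 2 * (4 : ℝ) ^ (m + 1) -
      (4 / 3 * R.Gfr 3 * U ^ 2 * (4 : ℝ) ^ 0 + 64 * lam3 * R.Gfr 1 * U ^ 2 * (4 : ℝ) ^ 0 + 16 / 3 * R.Gfr 3 * U ^ 2 * (4 : ℝ) ^ m) =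
      84 * (R.Gfr 3 * U ^ 2) + 336 * (R.Gfr 3 * U ^ 2 * (4 : ℝ) ^ m) := by ring
  rw [e]
  positivity

/-- The scale-0 order-4 slot budget shape sits below the dilated shape. -/
theorem msShapeZ4_slot {R : RenConsts} (hR : ∀ j, 0 ≤ R.Gfr j) (U : ℝ) (m : ℕ) (lam4 : ℝ) :
    16 / 15 * R.Gfr 4 * U ^ 2 * ((4 : ℝ) ^ 0) ^ 2 + 256 * lam4 * R.Gfr 1 * U ^ 2 * ((4 : ℝ) ^ 0) ^ 2 +
        64 / 15 * R.Gfr 4 * U ^ 2 * ((4 : ℝ) ^ m) ^ 2 ≤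
      16 / 15 * (16 * R.Gfr 4) * U ^ 2 * ((4 : ℝ) ^ 1) ^ 2 + lam4 * (16 * R.Gfr 1) * U ^ 2 * ((4 : ℝ) ^ 1) ^ 2 +
        64 / 15 * (16 * R.Gfr 4) * U ^ 2 * ((4 : ℝ) ^ (m + 1)) ^ 2 := by
  have h4 := hR 4
  rw [← sub_nonneg]
  have e : 16 / 15 * (16 * R.Gfr 4) * U ^ 2 * ((4 : ℝ) ^ 1) ^ 2 + lam4 * (16 * R.Gfr 1) * U ^ 2 * ((4 : ℝ) ^ 1) ^ 2 +
      64 / 15 * (16 * R.Gfr 4) * U ^ 2 * ((4 : ℝ) ^ (m + 1)) ^ 2 -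
      (16 / 15 * R.Gfr 4 * U ^ 2 * ((4 : ℝ) ^ 0) ^ 2 + 256 * lam4 * R.Gfr 1 * U ^ 2 * ((4 : ℝ) ^ 0) ^ 2 +
        64 / 15 * R.Gfr 4 * U ^ 2 * ((4 : ℝ) ^ m) ^ 2) =
      272 * (R.Gfr 4 * U ^ 2) + 1088 * (R.Gfr 4 * U ^ 2 * ((4 : ℝ) ^ m) ^ 2) := by ring
  rw [e]
  positivity

/-! ## §2 The slot fits at scale `0`, order by order -/

set_option maxHeartbeats 800000 in
set_option maxRecDepth 8000 in
/-- **(E3a-MS) SLOT FIT AT SCALE `0`, order 0** (`n₀ = 0`, `d = 4^0`, slot `m ≥ 1`): `msPieceSlotL … m 0 ≤ msBarQ G Q U 0 · pieceSize R U m 0`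
from the regime, the scale-0 Λ-shapes, the scale-0 profiles and the RESCALED package line `msReqSlot X (msMuZ mu) (msNuZ nu) (msRenZ R) lam3 lam4 0 ≤ 64·Q.CE·G.S 1·R.Gfr 0/4^0`
(dilation covariance: `ms_slot_fit_zero` at `y = 4^1`, `x = 4^(m+1)`, `G = 16·Gfr`). -/
theorem msPieceSlotL_le_scaleZero_zero {G : GeoConsts} {Q : EngConsts} {R : RenConsts} {X U c Λ₃ Λ₄ lam3 lam4 : ℝ}
    {σ ε : ℕ → ℕ → ℝ} {mu nu : ℕ → ℝ} {m : ℕ}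
    (hR : ∀ j, 0 ≤ R.Gfr j) (hU : 0 < U) (hU1 : U ≤ 1) (hm : 1 ≤ m) (hX : 0 ≤ X) (hCE : 0 ≤ Q.CE) (hS1' : 0 ≤ Q.S' 1) (hmu : ∀ i, 0 ≤ mu i) (hnu : ∀ i, 0 ≤ nu i) (hA0 : 0 ≤ msA R c U) (hd : klCurveD ≤ msDt - 2 * msA R c U) (hΛ₃0 : 0 ≤ Λ₃) (hΛ₄0 : 0 ≤ Λ₄) (hσ0 : ∀ k i, 0 ≤ σ k i) (hs1 : σ (m - 1) 1 ≤ 4 * mu 1 * U ^ 2) (hε0 : ∀ m i, 0 ≤ ε m i) (he0 : ε m 0 ≤ nu 0 * U ^ 2 * (R.Gfr 0 * U / ((4 : ℝ) ^ m) ^ 2)) (hfit : msReqSlot X (msMuZ mu) (msNuZ nu) (msRenZ R) lam3 lam4 0 ≤ 64 * (Q.CE * G.S 1 * R.Gfr 0) / (4 : ℝ) ^ 0) :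
    msPieceSlotL X σ ε R c U (4 ^ 0) 0 Λ₃ Λ₄ m 0 ≤ msBarQ G Q U 0 * (R.Gfr 0 * uPow 0 U * (4 : ℝ) ^ ((((0 : ℕ) : ℤ) - 2) * (m : ℤ))) := by
  have hUabs : |U| = U := abs_of_pos hU
  have hfit' := hfit.trans_eq (show (64 * (Q.CE * G.S 1 * R.Gfr 0) / (4 : ℝ) ^ 0 : ℝ) = Q.CE * 4 * G.S 1 * (16 * R.Gfr 0) by ring)
  have h1 := msSizeSlotO_le_zero (A := msA R c U) (A₃ := msA3L R U 0 (m - 0) Λ₃) (A₄ := msA4L R U 0 (m - 0) Λ₄) (Dt := msDt) (e := fun m' => msE (4 ^ 0) (pieceSize R U m')) (e₀ := 8 * R.Gfr 0 * U / ((4 : ℝ) ^ m) ^ 2) (l := 2 * ((4 : ℝ) ^ m)) (n₀ := 0) (m := m) (σ := σ) (ε := ε) (X := X)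
    (hX := hX) (hσ := hσ0) (hA0 := hA0) (hd := hd) (hA₃ := msA3L_nonneg hR U 0 _ hΛ₃0) (hA₄ := msA4L_nonneg hR U 0 _ hΛ₄0) (he := msE_pieceSize_nonneg hR U (4 ^ 0) m) (he₀ := by have := hR 0; have := hR 1; positivity) (hl := by have h4 : (1:ℝ) ≤ 4 ^ m := one_le_pow₀ (by norm_num); linarith) (hE0 := by simpa only [hUabs] using msE_pieceSize_zero_le_contraction (R := R) U (4 ^ 0) m)
  have h2 := ms_slot_fit_zero (X := X) (U := U) (x := (4 : ℝ) ^ (m + 1)) (y := (4 : ℝ) ^ 1) (CE := Q.CE * 4) (S1 := G.S 1) (S1' := Q.S' 1) (εm := ε m) (σ1 := σ (m - 0 - 1)) (μ := msMuZ mu) (ν := msNuZ nu) (e₀ := 8 * R.Gfr 0 * U / ((4 : ℝ) ^ m) ^ 2) (G0 := 16 * R.Gfr 0)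
    (hX := hX) (hU := hU) (hU1 := hU1) (hy := four_le_four_pow le_rfl) (hyx := four_mul_four_pow_le (Nat.succ_le_succ hm)) (hG0 := by have := hR 0; positivity) (hCE := by have := hCE; positivity) (hS1' := hS1') (hμ := msMuZ_nonneg hmu) (hν := msNuZ_nonneg hnu) (he₀0 := by have := hR 0; have := hR 1; positivity) (he₀ := le_of_eq (by field_simp; ring)) (hσ0 := fun i => hσ0 _ i) (hs1 := hs1.trans (le_of_eq (by simp only [msMuZ]; ring))) (hε0 := fun i => hε0 m i) (he0 := he0.trans (le_of_eq (by simp only [msNuZ]; field_simp; ring))) (hfit := hfit')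
  rw [show msPieceSlotL X σ ε R c U (4 ^ 0) 0 Λ₃ Λ₄ m 0 =
      msSizeSlotO X σ ε (msA R c U) (msA3L R U 0 (m - 0) Λ₃) (msA4L R U 0 (m - 0) Λ₄) msDt (fun m' => msE (4 ^ 0) (pieceSize R U m')) 0 m 0 from rfl,
    msBarQ_mul_pieceSize_zero G Q R hU 0 m]
  exact h1.trans (h2.trans (le_of_eq (by field_simp; ring)))

set_option maxHeartbeats 800000 in
set_option maxRecDepth 8000 in
/-- **(E3a-MS) SLOT FIT AT SCALE `0`, order 1** (`n₀ = 0`, `d = 4^0`, slot `m ≥ 1`): `msPieceSlotL … m 1 ≤ msBarQ G Q U 0 · pieceSize R U m 1`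
from the regime, the scale-0 Λ-shapes, the scale-0 profiles and the RESCALED package line `msReqSlot X (msMuZ mu) (msNuZ nu) (msRenZ R) lam3 lam4 1 ≤ 64·Q.CE·G.S 1·R.Gfr 1/4^1`
(dilation covariance: `ms_slot_fit_one` at `y = 4^1`, `x = 4^(m+1)`, `G = 16·Gfr`). -/
theorem msPieceSlotL_le_scaleZero_one {G : GeoConsts} {Q : EngConsts} {R : RenConsts} {X U c Λ₃ Λ₄ lam3 lam4 : ℝ}
    {σ ε : ℕ → ℕ → ℝ} {mu nu : ℕ → ℝ} {m : ℕ}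
    (hR : ∀ j, 0 ≤ R.Gfr j) (hU : 0 < U) (hU1 : U ≤ 1) (hm : 1 ≤ m) (hX : 0 ≤ X) (hCE : 0 ≤ Q.CE) (hS1' : 0 ≤ Q.S' 1) (hmu : ∀ i, 0 ≤ mu i) (hnu : ∀ i, 0 ≤ nu i) (hA0 : 0 ≤ msA R c U) (hA20 : msA R c U ≤ 1 / 20) (hd : klCurveD ≤ msDt - 2 * msA R c U) (hΛ₃0 : 0 ≤ Λ₃) (hΛ₄0 : 0 ≤ Λ₄) (hσ0 : ∀ k i, 0 ≤ σ k i) (hs1 : σ (m - 1) 1 ≤ 4 * mu 1 * U ^ 2) (hs2 : σ (m - 1) 2 ≤ mu 2 * U ^ 2) (hε0 : ∀ m i, 0 ≤ ε m i) (he1 : ε m 1 ≤ nu 1 * U ^ 2 * (R.Gfr 1 * U ^ 2 / (4 : ℝ) ^ m)) (hfit : msReqSlot X (msMuZ mu) (msNuZ nu) (msRenZ R) lam3 lam4 1 ≤ 64 * (Q.CE * G.S 1 * R.Gfr 1) / (4 : ℝ) ^ 1) :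
    msPieceSlotL X σ ε R c U (4 ^ 0) 0 Λ₃ Λ₄ m 1 ≤ msBarQ G Q U 0 * (R.Gfr 1 * uPow 1 U * (4 : ℝ) ^ ((((1 : ℕ) : ℤ) - 2) * (m : ℤ))) := by
  have hfit' := hfit.trans_eq (show (64 * (Q.CE * G.S 1 * R.Gfr 1) / (4 : ℝ) ^ 1 : ℝ) = Q.CE * G.S 1 * (16 * R.Gfr 1) by ring)
  have h1 := msSizeSlotO_le_one (A := msA R c U) (A₃ := msA3L R U 0 (m - 0) Λ₃) (A₄ := msA4L R U 0 (m - 0) Λ₄) (Dt := msDt) (e := fun m' => msE (4 ^ 0) (pieceSize R U m')) (η := 4 * (R.Gfr 1 + R.Gfr 2 + R.Gfr 3 + R.Gfr 4) * U ^ 2 / ((4 : ℝ) ^ m) ^ 2) (e₀ := 1923 * R.Gfr 1 * U ^ 2 / (((4 : ℝ) ^ m) * ((4 : ℝ) ^ 0))) (l := 2 * ((4 : ℝ) ^ m)) (n₀ := 0) (m := m) (σ := σ) (ε := ε) (X := X)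
    (hX := hX) (hσ := hσ0) (hε := hε0) (hA0 := hA0) (hA20 := hA20) (hd := hd) (hA₃ := msA3L_nonneg hR U 0 _ hΛ₃0) (hA₄ := msA4L_nonneg hR U 0 _ hΛ₄0) (he := msE_pieceSize_nonneg hR U (4 ^ 0) m) (hη := by have := hR 1; have := hR 2; have := hR 3; have := hR 4; positivity) (he₀ := by have := hR 0; have := hR 1; positivity) (hl := by have h4 : (1:ℝ) ≤ 4 ^ m := one_le_pow₀ (by norm_num); linarith) (hE0 := msE_pieceSize_zero_le_jackson hR U m 0) (hE1 := slotE_one hR U (4 ^ 0) m)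
  have h2 := ms_slot_fit_one (X := X) (U := U) (x := (4 : ℝ) ^ (m + 1)) (y := (4 : ℝ) ^ 1) (CE := Q.CE) (S1 := G.S 1) (S1' := Q.S' 1) (εm := ε m) (σ1 := σ (m - 0 - 1)) (μ := msMuZ mu) (ν := msNuZ nu) (η := 4 * (R.Gfr 1 + R.Gfr 2 + R.Gfr 3 + R.Gfr 4) * U ^ 2 / ((4 : ℝ) ^ m) ^ 2) (l := 2 * ((4 : ℝ) ^ m)) (e₀ := 1923 * R.Gfr 1 * U ^ 2 / (((4 : ℝ) ^ m) * ((4 : ℝ) ^ 0))) (Gb := 16 * R.Gfr 1 + 16 * R.Gfr 2 + 16 * R.Gfr 3 + 16 * R.Gfr 4) (G1 := 16 * R.Gfr 1)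
    (hX := hX) (hU := hU) (hU1 := hU1) (hy := four_le_four_pow le_rfl) (hyx := four_mul_four_pow_le (Nat.succ_le_succ hm)) (hGb := (by have := hR 1; have := hR 2; have := hR 3; have := hR 4; positivity)) (hG1 := by have := hR 1; positivity) (hCE := by have := hCE; positivity) (hS1' := hS1') (hμ := msMuZ_nonneg hmu) (hν := msNuZ_nonneg hnu) (hη0 := (by have := hR 1; have := hR 2; have := hR 3; have := hR 4; positivity)) (hη := le_of_eq (by field_simp; ring)) (hl0 := by positivity) (hl := by have h4 : (4 : ℝ) ^ m ≤ 4 ^ (m + 1) := pow_le_pow_right₀ (by norm_num) (Nat.le_succ m); linarith) (he₀0 := by have := hR 0; have := hR 1; positivity) (he₀ := le_of_eq (by field_simp; ring)) (hσ0 := fun i => hσ0 _ i) (hs1 := hs1.trans (le_of_eq (by simp only [msMuZ]; ring))) (hs2 := hs2.trans (le_of_eq (by simp only [msMuZ]; ring))) (hε0 := fun i => hε0 m i) (he1 := he1.trans (le_of_eq (by simp only [msNuZ]; field_simp; ring))) (hfit := hfit')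
  rw [show msPieceSlotL X σ ε R c U (4 ^ 0) 0 Λ₃ Λ₄ m 1 =
      msSizeSlotO X σ ε (msA R c U) (msA3L R U 0 (m - 0) Λ₃) (msA4L R U 0 (m - 0) Λ₄) msDt (fun m' => msE (4 ^ 0) (pieceSize R U m')) 0 m 1 from rfl,
    msBarQ_mul_pieceSize_one G Q R hU 0 m]
  exact h1.trans (h2.trans (le_of_eq (by field_simp; ring)))

set_option maxHeartbeats 800000 in
set_option maxRecDepth 8000 in
/-- **(E3a-MS) SLOT FIT AT SCALE `0`, order 2** (`n₀ = 0`, `d = 4^0`, slot `m ≥ 1`): `msPieceSlotL … m 2 ≤ msBarQ G Q U 0 · pieceSize R U m 2`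
from the regime, the scale-0 Λ-shapes, the scale-0 profiles and the RESCALED package line `msReqSlot X (msMuZ mu) (msNuZ nu) (msRenZ R) lam3 lam4 2 ≤ 64·Q.CE·G.S 1·R.Gfr 2/4^2`
(dilation covariance: `ms_slot_fit_two` at `y = 4^1`, `x = 4^(m+1)`, `G = 16·Gfr`). -/
theorem msPieceSlotL_le_scaleZero_two {G : GeoConsts} {Q : EngConsts} {R : RenConsts} {X U c Λ₃ Λ₄ lam3 lam4 : ℝ}
    {σ ε : ℕ → ℕ → ℝ} {mu nu : ℕ → ℝ} {m : ℕ}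
    (hR : ∀ j, 0 ≤ R.Gfr j) (hU : 0 < U) (hU1 : U ≤ 1) (hm : 1 ≤ m) (hX : 0 ≤ X) (hlam3 : 0 ≤ lam3) (hCE : 0 ≤ Q.CE) (hS1' : 0 ≤ Q.S' 1) (hmu : ∀ i, 0 ≤ mu i) (hnu : ∀ i, 0 ≤ nu i) (hA0 : 0 ≤ msA R c U) (hA20 : msA R c U ≤ 1 / 20) (hd : klCurveD ≤ msDt - 2 * msA R c U) (hΛ₃0 : 0 ≤ Λ₃) (hΛ₃ : Λ₃ ≤ 64 * lam3 * R.Gfr 1 * U ^ 2) (hΛ₄0 : 0 ≤ Λ₄) (hσ0 : ∀ k i, 0 ≤ σ k i) (hs1 : σ (m - 1) 1 ≤ 4 * mu 1 * U ^ 2) (hs2 : σ (m - 1) 2 ≤ mu 2 * U ^ 2) (hs3 : σ (m - 1) 3 ≤ mu 3 * U ^ 2 / 4) (hε0 : ∀ m i, 0 ≤ ε m i) (he1 : ε m 1 ≤ nu 1 * U ^ 2 * (R.Gfr 1 * U ^ 2 / (4 : ℝ) ^ m)) (he2 : ε m 2 ≤ nu 2 * U ^ 2 * (R.Gfr 2 *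 U ^ 2)) (hfit : msReqSlot X (msMuZ mu) (msNuZ nu) (msRenZ R) lam3 lam4 2 ≤ 64 * (Q.CE * G.S 1 * R.Gfr 2) / (4 : ℝ) ^ 2) :
    msPieceSlotL X σ ε R c U (4 ^ 0) 0 Λ₃ Λ₄ m 2 ≤ msBarQ G Q U 0 * (R.Gfr 2 * uPow 2 U * (4 : ℝ) ^ ((((2 : ℕ) : ℤ) - 2) * (m : ℤ))) := by
  have hfit' := hfit.trans_eq (show (64 * (Q.CE * G.S 1 * R.Gfr 2) / (4 : ℝ) ^ 2 : ℝ) = Q.CE / 4 * G.S 1 * (16 * R.Gfr 2) by ring)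
  have hΛ₃' : Λ₃ ≤ 64 * lam3 * R.Gfr 1 * U ^ 2 * (4 : ℝ) ^ 0 := by rw [pow_zero, mul_one]; exact hΛ₃
  have h1 := msSizeSlotO_le_two (A := msA R c U) (A₃ := msA3L R U 0 (m - 0) Λ₃) (A₄ := msA4L R U 0 (m - 0) Λ₄) (Dt := msDt) (e := fun m' => msE (4 ^ 0) (pieceSize R U m')) (η := 4 * (R.Gfr 1 + R.Gfr 2 + R.Gfr 3 + R.Gfr 4) * U ^ 2 / ((4 : ℝ) ^ m) ^ 2) (e₀ := 1923 * R.Gfr 1 * U ^ 2 / (((4 : ℝ) ^ m) * ((4 : ℝ) ^ 0))) (l := 2 * ((4 : ℝ) ^ m)) (n₀ := 0) (m := m) (σ := σ) (ε := ε) (X := X)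
    (hX := hX) (hσ := hσ0) (hε := hε0) (hA0 := hA0) (hA20 := hA20) (hd := hd) (hA₃ := msA3L_nonneg hR U 0 _ hΛ₃0) (hA₄ := msA4L_nonneg hR U 0 _ hΛ₄0) (he := msE_pieceSize_nonneg hR U (4 ^ 0) m) (hη := by have := hR 1; have := hR 2; have := hR 3; have := hR 4; positivity) (he₀ := by have := hR 0; have := hR 1; positivity) (hl := by have h4 : (1:ℝ) ≤ 4 ^ m := one_le_pow₀ (by norm_num); linarith) (hE0 := msE_pieceSize_zero_le_jackson hR U m 0) (hE1 := slotE_one hR U (4 ^ 0) m) (hE2 := slotE_two hR U (4 ^ 0) m)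
  have h2 := ms_slot_fit_two (X := X) (U := U) (x := (4 : ℝ) ^ (m + 1)) (y := (4 : ℝ) ^ 1) (CE := Q.CE / 4) (S1 := G.S 1) (S1' := Q.S' 1) (εm := ε m) (σ1 := σ (m - 0 - 1)) (μ := msMuZ mu) (ν := msNuZ nu) (η := 4 * (R.Gfr 1 + R.Gfr 2 + R.Gfr 3 + R.Gfr 4) * U ^ 2 / ((4 : ℝ) ^ m) ^ 2) (l := 2 * ((4 : ℝ) ^ m)) (e₀ := 1923 * R.Gfr 1 * U ^ 2 / (((4 : ℝ) ^ m) * ((4 : ℝ) ^ 0))) (A₃ := msA3L R U 0 (m - 0) Λ₃) (Gb := 16 * R.Gfr 1 + 16 * R.Gfr 2 + 16 * R.Gfr 3 + 16 * R.Gfr 4) (G1 := 16 * R.Gfr 1) (G2 := 16 * R.Gfr 2) (G3 := 16 * R.Gfr 3) (lam3 := lam3)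
    (hX := hX) (hU := hU) (hU1 := hU1) (hy := four_le_four_pow le_rfl) (hyx := four_mul_four_pow_le (Nat.succ_le_succ hm)) (hGb := (by have := hR 1; have := hR 2; have := hR 3; have := hR 4; positivity)) (hG1 := by have := hR 1; positivity) (hG2 := by have := hR 2; positivity) (hG3 := by have := hR 3; positivity) (hlam3 := hlam3) (hCE := by have := hCE; positivity) (hS1' := hS1') (hμ := msMuZ_nonneg hmu) (hν := msNuZ_nonneg hnu) (hη0 := (by have := hR 1; have := hR 2; have := hR 3; have := hR 4; positivity)) (hη := le_of_eq (by field_simp; ring)) (hl0 := by positivity) (hl := by have h4 : (4 : ℝ) ^ m ≤ 4 ^ (m + 1) := pow_le_pow_right₀ (by norm_num) (Nat.le_succ m); linarith) (he₀0 := by have := hR 0; have := hR 1; positivity) (he₀ := le_of_eq (by field_simp; ring)) (hA₃0 := msA3L_nonneg hR U 0 _ hΛ₃0) (hA₃ := (msA3L_le_shape (Nat.zero_le m) hΛ₃').trans (msShapeZ3_slot hR U m lam3)) (hσ0 := fun i => hσ0 _ i) (hs1 := hs1.trans (le_of_eq (by simp only [msMuZ]; ring))) (hs2 := hs2.trans (le_of_eq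 (by simp only [msMuZ]; ring))) (hs3 := hs3.trans (le_of_eq (by simp only [msMuZ]; ring))) (hε0 := fun i => hε0 m i) (he1 := he1.trans (le_of_eq (by simp only [msNuZ]; field_simp; ring))) (he2 := he2.trans (le_of_eq (by simp only [msNuZ]; field_simp; ring))) (hfit := hfit')
  rw [show msPieceSlotL X σ ε R c U (4 ^ 0) 0 Λ₃ Λ₄ m 2 =
      msSizeSlotO X σ ε (msA R c U) (msA3L R U 0 (m - 0) Λ₃) (msA4L R U 0 (m - 0) Λ₄) msDt (fun m' => msE (4 ^ 0) (pieceSize R U m')) 0 m 2 from rfl,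
    msBarQ_mul_pieceSize_two G Q R hU 0 m]
  exact h1.trans (h2.trans (le_of_eq (by field_simp; ring)))

set_option maxHeartbeats 800000 in
set_option maxRecDepth 8000 in
/-- **(E3a-MS) SLOT FIT AT SCALE `0`, order 3** (`n₀ = 0`, `d = 4^0`, slot `m ≥ 1`): `msPieceSlotL … m 3 ≤ msBarQ G Q U 0 · pieceSize R U m 3`
from the regime, the scale-0 Λ-shapes, the scale-0 profiles and the RESCALED package line `msReqSlot X (msMuZ mu) (msNuZ nu) (msRenZ R) lam3 lam4 3 ≤ 64·Q.CE·G.S 1·R.Gfr 3/4^3`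
(dilation covariance: `ms_slot_fit_three` at `y = 4^1`, `x = 4^(m+1)`, `G = 16·Gfr`). -/
theorem msPieceSlotL_le_scaleZero_three {G : GeoConsts} {Q : EngConsts} {R : RenConsts} {X U c Λ₃ Λ₄ lam3 lam4 : ℝ}
    {σ ε : ℕ → ℕ → ℝ} {mu nu : ℕ → ℝ} {m : ℕ}
    (hR : ∀ j, 0 ≤ R.Gfr j) (hU : 0 < U) (hU1 : U ≤ 1) (hm : 1 ≤ m) (hX : 0 ≤ X) (hlam3 : 0 ≤ lam3) (hlam4 : 0 ≤ lam4) (hCE : 0 ≤ Q.CE) (hS1' : 0 ≤ Q.S' 1) (hmu : ∀ i, 0 ≤ mu i) (hnu : ∀ i, 0 ≤ nu i) (hA0 : 0 ≤ msA R c U) (hA20 : msA R c U ≤ 1 / 20) (hd : klCurveD ≤ msDt - 2 * msA R c U) (hΛ₃0 : 0 ≤ Λ₃) (hΛ₃ : Λ₃ ≤ 64 * lam3 * R.Gfr 1 * U ^ 2) (hΛ₄0 : 0 ≤ Λ₄) (hΛ₄ : Λ₄ ≤ 256 * lam4 * R.Gfr 1 * U ^ 2) (hσ0 : ∀ k i,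 0 ≤ σ k i) (hs1 : σ (m - 1) 1 ≤ 4 * mu 1 * U ^ 2) (hs2 : σ (m - 1) 2 ≤ mu 2 * U ^ 2) (hs3 : σ (m - 1) 3 ≤ mu 3 * U ^ 2 / 4) (hs4 : σ (m - 1) 4 ≤ mu 4 * U ^ 2 / 16) (hε0 : ∀ m i, 0 ≤ ε m i) (he1 : ε m 1 ≤ nu 1 * U ^ 2 * (R.Gfr 1 * U ^ 2 / (4 : ℝ) ^ m)) (he2 : ε m 2 ≤ nu 2 * U ^ 2 * (R.Gfr 2 * U ^ 2)) (he3 : ε m 3 ≤ nu 3 * U ^ 2 * (R.Gfr 3 * U ^ 2 * (4 : ℝ) ^ m)) (hfit : msReqSlot X (msMuZ mu) (msNuZ nu) (msRenZ R) lam3 lam4 3 ≤ 64 * (Q.CE * G.S 1 * R.Gfr 3) / (4 : ℝ) ^ 3) :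
    msPieceSlotL X σ ε R c U (4 ^ 0) 0 Λ₃ Λ₄ m 3 ≤ msBarQ G Q U 0 * (R.Gfr 3 * uPow 3 U * (4 : ℝ) ^ ((((3 : ℕ) : ℤ) - 2) * (m : ℤ))) := by
  have hfit' := hfit.trans_eq (show (64 * (Q.CE * G.S 1 * R.Gfr 3) / (4 : ℝ) ^ 3 : ℝ) = Q.CE / 16 * G.S 1 * (16 * R.Gfr 3) by ring)
  have hΛ₃' : Λ₃ ≤ 64 * lam3 * R.Gfr 1 * U ^ 2 * (4 : ℝ) ^ 0 := by rw [pow_zero, mul_one]; exact hΛ₃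
  have hΛ₄' : Λ₄ ≤ 256 * lam4 * R.Gfr 1 * U ^ 2 * ((4 : ℝ) ^ 0) ^ 2 := by rw [pow_zero, one_pow, mul_one]; exact hΛ₄
  have h1 := msSizeSlotO_le_three (A := msA R c U) (A₃ := msA3L R U 0 (m - 0) Λ₃) (A₄ := msA4L R U 0 (m - 0) Λ₄) (Dt := msDt) (e := fun m' => msE (4 ^ 0) (pieceSize R U m')) (η := 4 * (R.Gfr 1 + R.Gfr 2 + R.Gfr 3 + R.Gfr 4) * U ^ 2 / ((4 : ℝ) ^ m) ^ 2) (e₀ := 1923 * R.Gfr 1 * U ^ 2 / (((4 : ℝ) ^ m) * ((4 : ℝ) ^ 0))) (l := 2 * ((4 : ℝ) ^ m)) (n₀ := 0) (m := m) (σ := σ) (ε := ε) (X := X)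
    (hX := hX) (hσ := hσ0) (hε := hε0) (hA0 := hA0) (hA20 := hA20) (hd := hd) (hA₃ := msA3L_nonneg hR U 0 _ hΛ₃0) (hA₄ := msA4L_nonneg hR U 0 _ hΛ₄0) (he := msE_pieceSize_nonneg hR U (4 ^ 0) m) (hη := by have := hR 1; have := hR 2; have := hR 3; have := hR 4; positivity) (he₀ := by have := hR 0; have := hR 1; positivity) (hl := by have h4 : (1:ℝ) ≤ 4 ^ m := one_le_pow₀ (by norm_num); linarith) (hE0 := msE_pieceSize_zero_le_jackson hR U m 0) (hE1 := slotE_one hR U (4 ^ 0) m) (hE2 := slotE_two hR U (4 ^ 0) m) (hE3 := slotE_three hR U (4 ^ 0) m)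
  have h2 := ms_slot_fit_three (X := X) (U := U) (x := (4 : ℝ) ^ (m + 1)) (y := (4 : ℝ) ^ 1) (CE := Q.CE / 16) (S1 := G.S 1) (S1' := Q.S' 1) (εm := ε m) (σ1 := σ (m - 0 - 1)) (μ := msMuZ mu) (ν := msNuZ nu) (η := 4 * (R.Gfr 1 + R.Gfr 2 + R.Gfr 3 + R.Gfr 4) * U ^ 2 / ((4 : ℝ) ^ m) ^ 2) (l := 2 * ((4 : ℝ) ^ m)) (e₀ := 1923 * R.Gfr 1 * U ^ 2 / (((4 : ℝ) ^ m) * ((4 : ℝ) ^ 0))) (A₃ := msA3L R U 0 (m - 0) Λ₃) (A₄ := msA4L R U 0 (m - 0) Λ₄) (Gb := 16 * R.Gfr 1 + 16 * R.Gfr 2 + 16 * R.Gfr 3 + 16 * R.Gfr 4) (G1 := 16 * R.Gfr 1) (G2 := 16 * R.Gfr 2) (G3 := 16 * R.Gfr 3) (G4 := 16 * R.Gfr 4) (lam3 := lam3) (lam4 := lam4)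
    (hX := hX) (hU := hU) (hU1 := hU1) (hy := four_le_four_pow le_rfl) (hyx := four_mul_four_pow_le (Nat.succ_le_succ hm)) (hGb := (by have := hR 1; have := hR 2; have := hR 3; have := hR 4; positivity)) (hG1 := by have := hR 1; positivity) (hG2 := by have := hR 2; positivity) (hG3 := by have := hR 3; positivity) (hG4 := by have := hR 4; positivity) (hlam3 := hlam3) (hlam4 := hlam4) (hCE := by have := hCE; positivity) (hS1' := hS1') (hμ := msMuZ_nonneg hmu) (hν := msNuZ_nonneg hnu) (hη0 := (by have := hR 1; have := hR 2; have := hR 3; have := hR 4; positivity)) (hη := le_of_eq (by field_simp; ring)) (hl0 := by positivity) (hl := by have h4 : (4 : ℝ) ^ m ≤ 4 ^ (m + 1) := pow_le_pow_right₀ (by norm_num) (Nat.le_succ m); linarith) (he₀0 := by have := hR 0; have := hR 1; positivity) (he₀ := le_of_eq (by field_simp; ring)) (hA₃0 := msA3L_nonneg hR U 0 _ hΛ₃0) (hA₃ := (msA3L_le_shape (Nat.zero_le m) hΛ₃').trans (msShapeZ3_slot hR U m lam3)) (hA₄0 := msA4L_nonneg hR U 0 _ hΛ₄0) (hA₄ :=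 (msA4L_le_shape (Nat.zero_le m) hΛ₄').trans (msShapeZ4_slot hR U m lam4)) (hσ0 := fun i => hσ0 _ i) (hs1 := hs1.trans (le_of_eq (by simp only [msMuZ]; ring))) (hs2 := hs2.trans (le_of_eq (by simp only [msMuZ]; ring))) (hs3 := hs3.trans (le_of_eq (by simp only [msMuZ]; ring))) (hs4 := hs4.trans (le_of_eq (by simp only [msMuZ]; ring))) (hε0 := fun i => hε0 m i) (he1 := he1.trans (le_of_eq (by simp only [msNuZ]; field_simp; ring))) (he2 := he2.trans (le_of_eq (by simp only [msNuZ]; field_simp; ring))) (he3 := he3.trans (le_of_eq (by simp only [msNuZ]; field_simp; ring))) (hfit := hfit')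
  rw [show msPieceSlotL X σ ε R c U (4 ^ 0) 0 Λ₃ Λ₄ m 3 =
      msSizeSlotO X σ ε (msA R c U) (msA3L R U 0 (m - 0) Λ₃) (msA4L R U 0 (m - 0) Λ₄) msDt (fun m' => msE (4 ^ 0) (pieceSize R U m')) 0 m 3 from rfl,
    msBarQ_mul_pieceSize_three G Q R hU 0 m]
  exact h1.trans (h2.trans (le_of_eq (by field_simp; ring)))

set_option maxHeartbeats 800000 in
set_option maxRecDepth 8000 in
/-- **(E3a-MS) SLOT FIT AT SCALE `0`, order 4** (`n₀ = 0`, `d = 4^0`, slot `m ≥ 1`): `msPieceSlotL … m 4 ≤ msBarQ G Q U 0 · pieceSize R U m 4`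
from the regime, the scale-0 Λ-shapes, the scale-0 profiles and the RESCALED package line `msReqSlot X (msMuZ mu) (msNuZ nu) (msRenZ R) lam3 lam4 4 ≤ 64·Q.CE·G.S 1·R.Gfr 4/4^4`
(dilation covariance: `ms_slot_fit_four` at `y = 4^1`, `x = 4^(m+1)`, `G = 16·Gfr`). -/
theorem msPieceSlotL_le_scaleZero_four {G : GeoConsts} {Q : EngConsts} {R : RenConsts} {X U c Λ₃ Λ₄ lam3 lam4 : ℝ}
    {σ ε : ℕ → ℕ → ℝ} {mu nu : ℕ → ℝ} {m : ℕ}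
    (hR : ∀ j, 0 ≤ R.Gfr j) (hU : 0 < U) (hU1 : U ≤ 1) (hm : 1 ≤ m) (hX : 0 ≤ X) (hlam3 : 0 ≤ lam3) (hlam4 : 0 ≤ lam4) (hCE : 0 ≤ Q.CE) (hS1' : 0 ≤ Q.S' 1) (hmu : ∀ i, 0 ≤ mu i) (hnu : ∀ i, 0 ≤ nu i) (hA0 : 0 ≤ msA R c U) (hA20 : msA R c U ≤ 1 / 20) (hd : klCurveD ≤ msDt - 2 * msA R c U) (hΛ₃0 : 0 ≤ Λ₃) (hΛ₃ : Λ₃ ≤ 64 * lam3 * R.Gfr 1 * U ^ 2) (hΛ₄0 : 0 ≤ Λ₄) (hΛ₄ : Λ₄ ≤ 256 * lam4 * R.Gfr 1 * U ^ 2) (hσ0 : ∀ k i, 0 ≤ σ k i) (hs1 : σ (m - 1) 1 ≤ 4 * mu 1 * U ^ 2) (hs2 : σ (m - 1) 2 ≤ mu 2 * U ^ 2) (hs3 : σ (m - 1) 3 ≤ mu 3 * U ^ 2 / 4) (hs4 : σ (m - 1) 4 ≤ mu 4 * U ^ 2 / 16) (hs5 : σ (m - 1) 5 ≤ mu 5 *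 U ^ 2 / 64) (hε0 : ∀ m i, 0 ≤ ε m i) (he1 : ε m 1 ≤ nu 1 * U ^ 2 * (R.Gfr 1 * U ^ 2 / (4 : ℝ) ^ m)) (he2 : ε m 2 ≤ nu 2 * U ^ 2 * (R.Gfr 2 * U ^ 2)) (he3 : ε m 3 ≤ nu 3 * U ^ 2 * (R.Gfr 3 * U ^ 2 * (4 : ℝ) ^ m)) (he4 : ε m 4 ≤ nu 4 * U ^ 2 * (R.Gfr 4 * U ^ 2 * ((4 : ℝ) ^ m) ^ 2)) (hfit : msReqSlot X (msMuZ mu) (msNuZ nu) (msRenZ R) lam3 lam4 4 ≤ 64 * (Q.CE * G.S 1 * R.Gfr 4) / (4 : ℝ) ^ 4) :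
    msPieceSlotL X σ ε R c U (4 ^ 0) 0 Λ₃ Λ₄ m 4 ≤ msBarQ G Q U 0 * (R.Gfr 4 * uPow 4 U * (4 : ℝ) ^ ((((4 : ℕ) : ℤ) - 2) * (m : ℤ))) := by
  have hfit' := hfit.trans_eq (show (64 * (Q.CE * G.S 1 * R.Gfr 4) / (4 : ℝ) ^ 4 : ℝ) = Q.CE / 64 * G.S 1 * (16 * R.Gfr 4) by ring)
  have hΛ₃' : Λ₃ ≤ 64 * lam3 * R.Gfr 1 * U ^ 2 * (4 : ℝ) ^ 0 := by rw [pow_zero, mul_one]; exact hΛ₃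
  have hΛ₄' : Λ₄ ≤ 256 * lam4 * R.Gfr 1 * U ^ 2 * ((4 : ℝ) ^ 0) ^ 2 := by rw [pow_zero, one_pow, mul_one]; exact hΛ₄
  have h1 := msSizeSlotO_le_four (A := msA R c U) (A₃ := msA3L R U 0 (m - 0) Λ₃) (A₄ := msA4L R U 0 (m - 0) Λ₄) (Dt := msDt) (e := fun m' => msE (4 ^ 0) (pieceSize R U m')) (η := 4 * (R.Gfr 1 + R.Gfr 2 + R.Gfr 3 + R.Gfr 4) * U ^ 2 / ((4 : ℝ) ^ m) ^ 2) (e₀ := 1923 * R.Gfr 1 * U ^ 2 / (((4 : ℝ) ^ m) * ((4 : ℝ) ^ 0))) (l := 2 * ((4 : ℝ) ^ m)) (n₀ := 0) (m := m) (σ := σ) (ε := ε) (X := X)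
    (hX := hX) (hσ := hσ0) (hε := hε0) (hA0 := hA0) (hA20 := hA20) (hd := hd) (hA₃ := msA3L_nonneg hR U 0 _ hΛ₃0) (hA₄ := msA4L_nonneg hR U 0 _ hΛ₄0) (he := msE_pieceSize_nonneg hR U (4 ^ 0) m) (hη := by have := hR 1; have := hR 2; have := hR 3; have := hR 4; positivity) (he₀ := by have := hR 0; have := hR 1; positivity) (hl := by have h4 : (1:ℝ) ≤ 4 ^ m := one_le_pow₀ (by norm_num); linarith) (hE0 := msE_pieceSize_zero_le_jackson hR U m 0) (hE1 := slotE_one hR U (4 ^ 0) m) (hE2 := slotE_two hR U (4 ^ 0) m) (hE3 := slotE_three hR U (4 ^ 0) m) (hE4 := slotE_four hR U (4 ^ 0) m)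
  have h2 := ms_slot_fit_four (X := X) (U := U) (x := (4 : ℝ) ^ (m + 1)) (y := (4 : ℝ) ^ 1) (CE := Q.CE / 64) (S1 := G.S 1) (S1' := Q.S' 1) (εm := ε m) (σ1 := σ (m - 0 - 1)) (μ := msMuZ mu) (ν := msNuZ nu) (η := 4 * (R.Gfr 1 + R.Gfr 2 + R.Gfr 3 + R.Gfr 4) * U ^ 2 / ((4 : ℝ) ^ m) ^ 2) (l := 2 * ((4 : ℝ) ^ m)) (e₀ := 1923 * R.Gfr 1 * U ^ 2 / (((4 : ℝ) ^ m) * ((4 : ℝ) ^ 0))) (A₃ := msA3L R U 0 (m - 0) Λ₃) (A₄ := msA4L R U 0 (m - 0) Λ₄) (Gb := 16 * R.Gfr 1 + 16 * R.Gfr 2 + 16 * R.Gfr 3 + 16 * R.Gfr 4) (G1 := 16 * R.Gfr 1) (G2 := 16 * R.Gfr 2) (G3 := 16 * R.Gfr 3) (G4 := 16 * R.Gfr 4) (lam3 := lam3) (lam4 := lam4)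
    (hX := hX) (hU := hU) (hU1 := hU1) (hy := four_le_four_pow le_rfl) (hyx := four_mul_four_pow_le (Nat.succ_le_succ hm)) (hGb := (by have := hR 1; have := hR 2; have := hR 3; have := hR 4; positivity)) (hG1 := by have := hR 1; positivity) (hG2 := by have := hR 2; positivity) (hG3 := by have := hR 3; positivity) (hG4 := by have := hR 4; positivity) (hlam3 := hlam3) (hlam4 := hlam4) (hCE := by have := hCE; positivity) (hS1' := hS1') (hμ := msMuZ_nonneg hmu) (hν := msNuZ_nonneg hnu) (hη0 := (by have := hR 1; have := hR 2; have := hR 3; have := hR 4; positivity)) (hη := le_of_eq (by field_simp; ring)) (hl0 := by positivity) (hl := by have h4 : (4 : ℝ) ^ m ≤ 4 ^ (m + 1) := pow_le_pow_right₀ (by norm_num) (Nat.le_succ m); linarith) (he₀0 := by have := hR 0; have := hR 1; positivity) (he₀ := le_of_eq (by field_simp; ring)) (hA₃0 := msA3L_nonneg hR U 0 _ hΛ₃0) (hA₃ := (msA3L_le_shape (Nat.zero_le m) hΛ₃').trans (msShapeZ3_slot hR U m lam3)) (hA₄0 := msA4L_nonneg hR U 0 _ hΛ₄0) (hA₄ :=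 (msA4L_le_shape (Nat.zero_le m) hΛ₄').trans (msShapeZ4_slot hR U m lam4)) (hσ0 := fun i => hσ0 _ i) (hs1 := hs1.trans (le_of_eq (by simp only [msMuZ]; ring))) (hs2 := hs2.trans (le_of_eq (by simp only [msMuZ]; ring))) (hs3 := hs3.trans (le_of_eq (by simp only [msMuZ]; ring))) (hs4 := hs4.trans (le_of_eq (by simp only [msMuZ]; ring))) (hs5 := hs5.trans (le_of_eq (by simp only [msMuZ]; ring))) (hε0 := fun i => hε0 m i) (he1 := he1.trans (le_of_eq (by simp only [msNuZ]; field_simp; ring))) (he2 := he2.trans (le_of_eq (by simp only [msNuZ]; field_simp; ring))) (he3 := he3.trans (le_of_eq (by simp only [msNuZ]; field_simp; ring))) (he4 := he4.trans (le_of_eq (by simp only [msNuZ]; field_simp; ring))) (hfit := hfit')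
  rw [show msPieceSlotL X σ ε R c U (4 ^ 0) 0 Λ₃ Λ₄ m 4 =
      msSizeSlotO X σ ε (msA R c U) (msA3L R U 0 (m - 0) Λ₃) (msA4L R U 0 (m - 0) Λ₄) msDt (fun m' => msE (4 ^ 0) (pieceSize R U m')) 0 m 4 from rfl,
    msBarQ_mul_pieceSize_four G Q R hU 0 m]
  exact h1.trans (h2.trans (le_of_eq (by field_simp; ring)))

/-- **(E3a-MS) SLOT FITS AT SCALE `0`, all orders `j ≤ 4`** — the literal `hfit_m` input of `twoLegSizesMSTQ_zero_of_pieces_mixed` at `d = 4^0`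
for one slot `m ≥ 1`. -/
theorem msPieceSlotL_le_scaleZero {G : GeoConsts} {Q : EngConsts} {R : RenConsts} {X U c Λ₃ Λ₄ lam3 lam4 : ℝ}
    {σ ε : ℕ → ℕ → ℝ} {mu nu : ℕ → ℝ} {m : ℕ}
    (hR : ∀ j, 0 ≤ R.Gfr j) (hU : 0 < U) (hU1 : U ≤ 1) (hm : 1 ≤ m) (hX : 0 ≤ X)
    (hlam3 : 0 ≤ lam3) (hlam4 : 0 ≤ lam4) (hCE : 0 ≤ Q.CE) (hS1' : 0 ≤ Q.S' 1) (hmu : ∀ i, 0 ≤ mu i) (hnu : ∀ i, 0 ≤ nu i)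
    (hA0 : 0 ≤ msA R c U) (hA20 : msA R c U ≤ 1 / 20) (hd : klCurveD ≤ msDt - 2 * msA R c U)
    (hΛ₃0 : 0 ≤ Λ₃) (hΛ₃ : Λ₃ ≤ 64 * lam3 * R.Gfr 1 * U ^ 2) (hΛ₄0 : 0 ≤ Λ₄) (hΛ₄ : Λ₄ ≤ 256 * lam4 * R.Gfr 1 * U ^ 2)
    (hσ0 : ∀ k i, 0 ≤ σ k i) (hs1 : σ (m - 1) 1 ≤ 4 * mu 1 * U ^ 2) (hs2 : σ (m - 1) 2 ≤ mu 2 * U ^ 2) (hs3 : σ (m - 1) 3 ≤ mu 3 * U ^ 2 / 4) (hs4 : σ (m - 1) 4 ≤ mu 4 * U ^ 2 / 16) (hs5 : σ (m - 1) 5 ≤ mu 5 * U ^ 2 / 64)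
    (hε0 : ∀ m i, 0 ≤ ε m i) (he0 : ε m 0 ≤ nu 0 * U ^ 2 * (R.Gfr 0 * U / ((4 : ℝ) ^ m) ^ 2)) (he1 : ε m 1 ≤ nu 1 * U ^ 2 * (R.Gfr 1 * U ^ 2 / (4 : ℝ) ^ m)) (he2 : ε m 2 ≤ nu 2 * U ^ 2 * (R.Gfr 2 * U ^ 2)) (he3 : ε m 3 ≤ nu 3 * U ^ 2 * (R.Gfr 3 * U ^ 2 * (4 : ℝ) ^ m)) (he4 : ε m 4 ≤ nu 4 * U ^ 2 * (R.Gfr 4 * U ^ 2 * ((4 : ℝ) ^ m) ^ 2))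
    (hfit : ∀ j ≤ 4, msReqSlot X (msMuZ mu) (msNuZ nu) (msRenZ R) lam3 lam4 j ≤ 64 * (Q.CE * G.S 1 * R.Gfr j) / (4 : ℝ) ^ j) :
    ∀ j ≤ 4, msPieceSlotL X σ ε R c U (4 ^ 0) 0 Λ₃ Λ₄ m j ≤ msBarQ G Q U 0 * (R.Gfr j * uPow j U * (4 : ℝ) ^ (((j : ℤ) - 2) * m)) := by
  intro j hj
  interval_cases j
  · exact msPieceSlotL_le_scaleZero_zero hR hU hU1 hm hX hCE hS1' hmu hnu hA0 hd hΛ₃0 hΛ₄0 hσ0 hs1 hε0 he0 (hfit 0 (by norm_num))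
  · exact msPieceSlotL_le_scaleZero_one hR hU hU1 hm hX hCE hS1' hmu hnu hA0 hA20 hd hΛ₃0 hΛ₄0 hσ0 hs1 hs2 hε0 he1 (hfit 1 (by norm_num))
  · exact msPieceSlotL_le_scaleZero_two hR hU hU1 hm hX hlam3 hCE hS1' hmu hnu hA0 hA20 hd hΛ₃0 hΛ₃ hΛ₄0 hσ0 hs1 hs2 hs3 hε0 he1 he2
      (hfit 2 (by norm_num))
  · exact msPieceSlotL_le_scaleZero_three hR hU hU1 hm hX hlam3 hlam4 hCE hS1' hmu hnu hA0 hA20 hd hΛ₃0 hΛ₃ hΛ₄0 hΛ₄ hσ0 hs1 hs2 hs3 hs4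
      hε0 he1 he2 he3 (hfit 3 (by norm_num))
  · exact msPieceSlotL_le_scaleZero_four hR hU hU1 hm hX hlam3 hlam4 hCE hS1' hmu hnu hA0 hA20 hd hΛ₃0 hΛ₃ hΛ₄0 hΛ₄ hσ0 hs1 hs2 hs3 hs4 hs5
      hε0 he1 he2 he3 he4 (hfit 4 le_rfl)

end Summit.HubbardSuperconductivity.HubbardSuperconductivity.Theorems.KLRegimeSplit

end
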